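import Summits.BirchSwinnertonDyer.Rank1Residual.GaloisImage.TameThreeAdicTowerIIIstar
import Summits.BirchSwinnertonDyer.Rank1Residual.GaloisImage.ThreeTorsionInertiaTame
import Summits.BirchSwinnertonDyer.Rank1Residual.GaloisImage.TameThreeKodairaShapeInt
import Literature.NumberTheory.EllipticCurves.QuadraticTwistTateFormTwoProofs
import Literature.NumberTheory.EllipticCurves.GlobalMinimalModelProofs
import Literature.NumberTheory.DiophantineGeometry.Conductor
import HarnessLib

/-!
# THE TAME `3`-ADIC TOWER: `ρ̄_{E,3}` onto and Kodaira type `III` or `III*` at `3` ⟹ `ρ̄_{E,3ⁿ}` onto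
# for every `n` (cell `b2b-bsdres`, team n1011, seat p14 gen 2 — lead author of OWNERS row T-b9
# 'tame tower at 3'; targets T1/T2 of `cells/n1011/skel/T-b9-tame-tower.md`)

HONEST FRAMING (cell `b2b-bsdres`, run/shared/lean/b2b/bsd-rank1-residual/, verbatim in every
file): the goal of the cell is to DELETE the COMBINATION-SHAPED residual classes of the
Birch–Swinnerton-Dyer formula for ALL analytic-rank `≤ 1` elliptic curves over `ℚ` — "full BSD
formula for every rank `≤ 1` curve in class `C`" assembled STRICTLY from published theorems — so
that the rank-`≤ 1` remainder becomes exactly the CONSTRUCTION-SHAPED classes, which are TYPED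
(missing-input `Prop`s), NOT attempted. This is not "finishing BSD". Team n1011 (N10 / N11, the
additive block X4 ∧ `p = 3`): research route on the CONSTRUCTION-SHAPED class X4; no claim beyond the
stated classes; the label X4 is UNCHANGED by this file; nothing is booked. Theorems only (no
definition, no named fact; OUR result — Summits side).

## What this file proves

Wuthrich's Lemma 20 ([Wuthrich2014] p. 399: for `E/ℚ` SEMISTABLE at `3`, `ρ̄_{E,3}` onto ⟹ `ρ_{E,3^∞}`
onto) extended to TAME ADDITIVE reduction of Kodaira type `III` / `III*` at `3` (semistability defect
`e = 4`):

* `towerSurj_three_of_surj_of_shapeIII` / `…_of_shapeIIIstar` — for an integral equation `V` in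
  `III`-shape (`3 ∣ b₂`, `3 ∥ b₄`, `9 ∣ b₆`) resp. `III*`-shape (`9 ∣ b₂`, `27 ∥ b₄`, `3⁵ ∣ b₆`),
  elliptic over `ℚ`: surj(3) ⟹ `ρ̄_{E,3ⁿ}` onto for all `n` — CASE A (`TameThreeAdicTower[IIIstar]`,
  `27 ∣ e₉`) and CASE B closed here: `4 ∣ e₃` (`four_dvd_card_inertia_map_three_of_shapeIII[star]_caseB`)
  ⟹ `3 ∤ e₃` (n1011-p02's `not_three_dvd_card_inertia_map_galoisRepTorsion_three_of_four_dvd`, the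
  tame character + `GL₂(𝔽₃)` normaliser lemma) ⟹ the criterion with `36 ∣ e₉`;
* `towerSurj_three_of_surj_of_kodairaSymbolAt_eq_III` / `…_eq_IIIstar` / `…_III_or_IIIstar` — for
  `W/ℚ` elliptic and GLOBALLY MINIMAL with Kodaira symbol `III` (resp. `III*`) at a place `v` over
  `3` of any integer ring of `ℚ` (e.g. `placeOf 3`): surj(3) ⟹ the tower, through n1011-p04's
  Kodaira bridge `exists_IIIShape_intModel_three'` / `exists_IIIstarShape_intModel_three'` (an
  integer translate of the minimal model is `III`/`III*`-shaped, same mod-`n` images);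
* `towerSurj_three_of_surj_of_kodairaSymbolAt_III_or_IIIstar'` — the same for ANY elliptic `W/ℚ`
  (global minimal model `hasGlobalMinimalModel_rat_holds`, invariance `kodairaSymbolAt_smul'`,
  `hasSurjectiveModNGaloisRep_smul_iff`);
* `imageContainsSL2_three_of_surj_of_kodairaSymbolAt_III_or_IIIstar` — Kato's (12.5.2) at `3`.

With `Additive/TypeGThreeTowerOfSurj.lean` (p251574: the tower on every Kodaira-`I₀*` row) this is
the tower from the census bit surj(3) on EVERY TAME additive row of X4 at `3` (`I₀*`, `III`, `III*`;
the potentially multiplicative rows `Iₙ*` by p249079); the EXOTIC residue of the X4 end-state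
(surj(3), tower fails) is thereby confined to the Kodaira types `II, IV, IV*, II*` at `3` — the WILD
ones (Kraus 1990: `3 ∣ #Φ`; `v₃(N) ≥ 3`) — see the sequel `Additive/X4ExoticWild.lean`.  Census
stake (EVIDENCE, T-b1 engine 1, `HOME/b2b-bsdres-n1011-p14/e4/TAME-TOWER-NOTE.md`): 7 346 surj(3)
Kodaira `III`/`III*` X4@3 `r_an = 0` cells (+ 1 273 `r_an = 1`) get the tower as a THEOREM and 451
mod-`9` certificates become unnecessary; the criterion fails on 0 of them, on every wild cell and on
Elkies' `9`-deficient curves (`v₃(N) = 5`).  Nothing booked; X4 stays CONSTRUCTION-SHAPED.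

References: [Wuthrich2014] Lemma 20 (p. 399); [SerreAbelianLadic1968] IV-23 Lemma 3;
[SerreLocalFields1979] Ch. IV §2; [Serre1972] §4.1; [SilvermanATAEC1994] IV.9.4 (Tate's algorithm,
types `III`, `III*`); [Kato2004Asterisque] (12.5.2) p. 222; A. Kraus, Manuscripta Math. 69 (1990)
353–385 (the tame/wild dictionary at `3`, cited in docstrings only).
-/

noncomputable section

open scoped Classical NumberField

open Polynomial WeierstrassCurve IsDedekindDomain Field

namespace Summit.BirchSwinnertonDyer.Rank1Residual.GaloisImage

open Literature.NumberTheory.EllipticCurves Literature.NumberTheory.GaloisRepresentations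
  Rat.HeightOneSpectrum

/-! ### §1. Integral equations in `III` / `III*` shape: CASE B closed, and the full shape theorems -/

section Shape

variable (V : WeierstrassCurve ℤ)

/-- The place of `𝓞 ℚ` over `3`, in the `primesEquiv` presentation used by the inertia criterion.
[folklore] -/
private theorem exists_place_three : ∃ v : HeightOneSpectrum (𝓞 ℚ), (primesEquiv v : ℕ) = 3 :=
  ⟨primesEquiv.symm ⟨3, Nat.prime_three⟩, by rw [Equiv.apply_symm_apply]⟩

/-- **Tame tower, Kodaira-`III` shape, CASE B (`9 ∣ b₂`) — closed.**  For an integral equation `V`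
with `9 ∣ b₂`, `3 ∥ b₄`, `9 ∣ b₆`, elliptic over `ℚ`: `ρ̄_{E,3}` onto ⟹ `ρ̄_{E,3ⁿ}` onto for all
`n`.  The `3`-torsion abscissa valuation `1/4` gives `4 ∣ e₃ = #ρ̄₃(I_𝔓)`
(`four_dvd_card_inertia_map_three_of_shapeIII_caseB`), hence `3 ∤ e₃` (p02's
`not_three_dvd_card_inertia_map_galoisRepTorsion_three_of_four_dvd`), and
`towerSurj_three_of_surj_of_shapeIII_caseB_of_not_three_dvd` (`36 ∣ e₉`) applies.
[cite: SerreAbelianLadic1968, Ch. IV §3.4, Lemma 3 (IV-23)] [cite: SerreLocalFields1979, Ch. IV §2 Cor. 1] -/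
theorem towerSurj_three_of_surj_of_shapeIII_caseB [hE : (V.map (Int.castRingHom ℚ)).IsElliptic]
    (hb2 : (9 : ℤ) ∣ V.b₂) (hb4 : (3 : ℤ) ∣ V.b₄) (hb4' : ¬ (9 : ℤ) ∣ V.b₄) (hb6 : (9 : ℤ) ∣ V.b₆)
    (hsurj : (V.map (Int.castRingHom ℚ)).HasSurjectiveModNGaloisRep 3)
    (n : ℕ) : (V.map (Int.castRingHom ℚ)).HasSurjectiveModNGaloisRep (3 ^ n : ℕ) := by
  haveI : Fact (Nat.Prime 3) := ⟨Nat.prime_three⟩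
  obtain ⟨v, hv⟩ := exists_place_three
  obtain ⟨𝔓, hmem, h𝔓⟩ := exists_ideal_placeOver 3 hv
  exact towerSurj_three_of_surj_of_shapeIII_caseB_of_not_three_dvd V hb2 hb4 hb4' hb6 hsurj hv hmem
    h𝔓 (not_three_dvd_card_inertia_map_galoisRepTorsion_three_of_four_dvd hv h𝔓
      (four_dvd_card_inertia_map_three_of_shapeIII_caseB V hb2 hb4 hb4' hb6 hv hmem h𝔓)) n

/-- **THE TAME TOWER ON A KODAIRA-`III`-SHAPED EQUATION.**  For an integral Weierstrass equation `V`
with `3 ∣ b₂`, `3 ∣ b₄`, `9 ∤ b₄`, `9 ∣ b₆` (the shape of an integer translate of a minimal model of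
Kodaira type `III` at `3`), elliptic over `ℚ`: `ρ̄_{E,3}` onto ⟹ `ρ̄_{E,3ⁿ}` onto for every `n`
(CASE A `3 ∥ b₂`: `towerSurj_three_of_surj_of_shapeIII_caseA`; CASE B `9 ∣ b₂`: the previous
theorem). [cite: Wuthrich2014, Lemma 20 (p. 399)] [cite: SerreAbelianLadic1968, Ch. IV §3.4, Lemma 3 (IV-23)] -/
theorem towerSurj_three_of_surj_of_shapeIII [hE : (V.map (Int.castRingHom ℚ)).IsElliptic]
    (hb2 : (3 : ℤ) ∣ V.b₂) (hb4 : (3 : ℤ) ∣ V.b₄) (hb4' : ¬ (9 : ℤ) ∣ V.b₄) (hb6 : (9 : ℤ) ∣ V.b₆)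
    (hsurj : (V.map (Int.castRingHom ℚ)).HasSurjectiveModNGaloisRep 3)
    (n : ℕ) : (V.map (Int.castRingHom ℚ)).HasSurjectiveModNGaloisRep (3 ^ n : ℕ) := by
  by_cases h9 : (9 : ℤ) ∣ V.b₂
  · exact towerSurj_three_of_surj_of_shapeIII_caseB V h9 hb4 hb4' hb6 hsurj n
  · exact towerSurj_three_of_surj_of_shapeIII_caseA V hb2 h9 hb4 hb4' hb6 hsurj n

/-- **Tame tower, Kodaira-`III*` shape, CASE B′ (`27 ∣ b₂`) — closed** (`v(ξ)⁴ = v(3)⁵` ⟹ `4 ∣ e₃`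
⟹ `3 ∤ e₃`; `v(x)³⁶ = v(3)⁵³` ⟹ `36 ∣ e₉`).
[cite: SerreAbelianLadic1968, Ch. IV §3.4, Lemma 3 (IV-23)] [cite: SerreLocalFields1979, Ch. IV §2 Cor. 1] -/
theorem towerSurj_three_of_surj_of_shapeIIIstar_caseB [hE : (V.map (Int.castRingHom ℚ)).IsElliptic]
    (hb2 : (27 : ℤ) ∣ V.b₂) (hb4 : (27 : ℤ) ∣ V.b₄) (hb4' : ¬ (81 : ℤ) ∣ V.b₄)
    (hb6 : (243 : ℤ) ∣ V.b₆) (hsurj : (V.map (Int.castRingHom ℚ)).HasSurjectiveModNGaloisRep 3)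
    (n : ℕ) : (V.map (Int.castRingHom ℚ)).HasSurjectiveModNGaloisRep (3 ^ n : ℕ) := by
  haveI : Fact (Nat.Prime 3) := ⟨Nat.prime_three⟩
  obtain ⟨v, hv⟩ := exists_place_three
  obtain ⟨𝔓, hmem, h𝔓⟩ := exists_ideal_placeOver 3 hv
  exact towerSurj_three_of_surj_of_shapeIIIstar_caseB_of_not_three_dvd V hb2 hb4 hb4' hb6 hsurj hv
    hmem h𝔓 (not_three_dvd_card_inertia_map_galoisRepTorsion_three_of_four_dvd hv h𝔓
      (four_dvd_card_inertia_map_three_of_shapeIIIstar_caseB V hb2 hb4 hb4' hb6 hv hmem h𝔓)) n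

/-- **THE TAME TOWER ON A KODAIRA-`III*`-SHAPED EQUATION**: `9 ∣ b₂`, `27 ∣ b₄`, `81 ∤ b₄`,
`243 ∣ b₆`, elliptic over `ℚ`: `ρ̄_{E,3}` onto ⟹ `ρ̄_{E,3ⁿ}` onto for every `n` (CASE A′ `9 ∥ b₂`:
`towerSurj_three_of_surj_of_shapeIIIstar_caseA`; CASE B′ `27 ∣ b₂`).
[cite: Wuthrich2014, Lemma 20 (p. 399)] [cite: SerreAbelianLadic1968, Ch. IV §3.4, Lemma 3 (IV-23)] -/
theorem towerSurj_three_of_surj_of_shapeIIIstar [hE : (V.map (Int.castRingHom ℚ)).IsElliptic]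
    (hb2 : (9 : ℤ) ∣ V.b₂) (hb4 : (27 : ℤ) ∣ V.b₄) (hb4' : ¬ (81 : ℤ) ∣ V.b₄)
    (hb6 : (243 : ℤ) ∣ V.b₆) (hsurj : (V.map (Int.castRingHom ℚ)).HasSurjectiveModNGaloisRep 3)
    (n : ℕ) : (V.map (Int.castRingHom ℚ)).HasSurjectiveModNGaloisRep (3 ^ n : ℕ) := by
  by_cases h27 : (27 : ℤ) ∣ V.b₂
  · exact towerSurj_three_of_surj_of_shapeIIIstar_caseB V h27 hb4 hb4' hb6 hsurj n
  · exact towerSurj_three_of_surj_of_shapeIIIstar_caseA V hb2 h27 hb4 hb4' hb6 hsurj n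

end Shape

/-! ### §2. Globally minimal `W/ℚ` with Kodaira symbol `III` / `III*` at `3` -/

section Kodaira

variable (W : WeierstrassCurve ℚ) [W.IsElliptic]
variable {R : Type*} [CommRing R] [IsDedekindDomain R] [Algebra R ℚ] [IsFractionRing R ℚ]
  [IsIntegralClosure R ℤ ℚ]

/-- **T1. THE TAME TOWER, KODAIRA TYPE `III` AT `3`.**  For `W/ℚ` elliptic and globally minimal with
Kodaira symbol `III` at a place `v` over `3` (of any integer ring of `ℚ`, e.g. `v = placeOf 3`):
`ρ̄_{E,3}` onto ⟹ `ρ̄_{E,3ⁿ}` onto for every `n`.  (p04's bridge `exists_IIIShape_intModel_three'`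
+ `towerSurj_three_of_surj_of_shapeIII`.) [cite: Wuthrich2014, Lemma 20 (p. 399)]
[cite: SilvermanATAEC1994, IV.9.4 Steps 2–4] [cite: SerreAbelianLadic1968, Ch. IV §3.4, Lemma 3 (IV-23)] -/
theorem towerSurj_three_of_surj_of_kodairaSymbolAt_eq_III [W.IsGloballyMinimal]
    (v : HeightOneSpectrum R) (hv : natGenerator v = 3) (hW : W.kodairaSymbolAt v = .III)
    (hsurj : W.HasSurjectiveModNGaloisRep 3) (n : ℕ) :
    W.HasSurjectiveModNGaloisRep (3 ^ n : ℕ) := by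
  obtain ⟨V, -, hb2, hb4, hb4', hb6, hE, hiff⟩ := exists_IIIShape_intModel_three' v W hv hW
  haveI := hE
  exact (hiff _).mp (towerSurj_three_of_surj_of_shapeIII V hb2 hb4 hb4' hb6 ((hiff 3).mpr hsurj) n)

/-- **T2. THE TAME TOWER, KODAIRA TYPE `III*` AT `3`** (globally minimal `W`, any presentation of the
place over `3`): `ρ̄_{E,3}` onto ⟹ `ρ̄_{E,3ⁿ}` onto for every `n`.
[cite: Wuthrich2014, Lemma 20 (p. 399)] [cite: SilvermanATAEC1994, IV.9.4 Steps 6–9]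
[cite: SerreAbelianLadic1968, Ch. IV §3.4, Lemma 3 (IV-23)] -/
theorem towerSurj_three_of_surj_of_kodairaSymbolAt_eq_IIIstar [W.IsGloballyMinimal]
    (v : HeightOneSpectrum R) (hv : natGenerator v = 3) (hW : W.kodairaSymbolAt v = .IIIstar)
    (hsurj : W.HasSurjectiveModNGaloisRep 3) (n : ℕ) :
    W.HasSurjectiveModNGaloisRep (3 ^ n : ℕ) := by
  obtain ⟨V, -, hb2, hb4, hb4', hb6, hE, hiff⟩ := exists_IIIstarShape_intModel_three' v W hv hW
  haveI := hE
  exact (hiff _).mp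
    (towerSurj_three_of_surj_of_shapeIIIstar V hb2 hb4 hb4' hb6 ((hiff 3).mpr hsurj) n)

/-- **T1 + T2: the tame tower at `3`** for a globally minimal `W/ℚ` with Kodaira symbol `III` or
`III*` at the place over `3`: surj(3) ⟹ `∀ n, ρ̄_{E,3ⁿ}` onto.
[cite: Wuthrich2014, Lemma 20 (p. 399)] [cite: SerreAbelianLadic1968, Ch. IV §3.4, Lemma 3 (IV-23)] -/
theorem towerSurj_three_of_surj_of_kodairaSymbolAt_III_or_IIIstar [W.IsGloballyMinimal]
    (v : HeightOneSpectrum R) (hv : natGenerator v = 3)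
    (hW : W.kodairaSymbolAt v = .III ∨ W.kodairaSymbolAt v = .IIIstar)
    (hsurj : W.HasSurjectiveModNGaloisRep 3) (n : ℕ) :
    W.HasSurjectiveModNGaloisRep (3 ^ n : ℕ) :=
  hW.elim (fun h ↦ towerSurj_three_of_surj_of_kodairaSymbolAt_eq_III W v hv h hsurj n)
    fun h ↦ towerSurj_three_of_surj_of_kodairaSymbolAt_eq_IIIstar W v hv h hsurj n

/-- **The tame tower at `3` for ANY elliptic Weierstrass equation over `ℚ`** (not necessarily
minimal): Kodaira symbol `III` or `III*` at a place over `3` and `ρ̄_{E,3}` onto ⟹ `ρ̄_{E,3ⁿ}` onto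
for every `n`.  Reduction to the globally minimal model (`hasGlobalMinimalModel_rat_holds`; the
Kodaira symbol and the mod-`n` images are isomorphism invariants: `kodairaSymbolAt_smul'`,
`hasSurjectiveModNGaloisRep_smul_iff`). [cite: Wuthrich2014, Lemma 20 (p. 399)]
[cite: SilvermanAEC2009, VIII.8, Cor. 8.3, p. 213] [cite: SilvermanATAEC1994, IV.9.4] -/
theorem towerSurj_three_of_surj_of_kodairaSymbolAt_III_or_IIIstar'
    (v : HeightOneSpectrum R) (hv : natGenerator v = 3)
    (hW : W.kodairaSymbolAt v = .III ∨ W.kodairaSymbolAt v = .IIIstar)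
    (hsurj : W.HasSurjectiveModNGaloisRep 3) (n : ℕ) :
    W.HasSurjectiveModNGaloisRep (3 ^ n : ℕ) := by
  obtain ⟨C, hC⟩ := hasGlobalMinimalModel_rat_holds W
  haveI := hC
  haveI : PerfectField (IsLocalRing.ResidueField (v.adicCompletionIntegers ℚ)) :=
    PerfectField.ofFinite
  have hK : (C • W).kodairaSymbolAt v = .III ∨ (C • W).kodairaSymbolAt v = .IIIstar := by
    rw [kodairaSymbolAt_smul' v W C]; exact hW
  exact (hasSurjectiveModNGaloisRep_smul_iff W C _).mp
    (towerSurj_three_of_surj_of_kodairaSymbolAt_III_or_IIIstar (C • W) v hv hK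
      ((hasSurjectiveModNGaloisRep_smul_iff W C 3).mpr hsurj) n)

/-- **Kato's (12.5.2) at `3` on the tame `e = 4` rows**: Kodaira `III` or `III*` at `3` and
`ρ̄_{E,3}` onto ⟹ `Kato2004.ImageContainsSL2 W 3` (any elliptic `W/ℚ`).
[cite: Kato2004Asterisque, (12.5.2) (p. 222)] [cite: Wuthrich2014, Lemma 20 (p. 399)] -/
theorem imageContainsSL2_three_of_surj_of_kodairaSymbolAt_III_or_IIIstar
    (v : HeightOneSpectrum R) (hv : natGenerator v = 3)
    (hW : W.kodairaSymbolAt v = .III ∨ W.kodairaSymbolAt v = .IIIstar)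
    (hsurj : W.HasSurjectiveModNGaloisRep 3) : Kato2004.ImageContainsSL2 W 3 := by
  haveI : Fact (Nat.Prime 3) := ⟨Nat.prime_three⟩
  exact (Kato2004.imageContainsSL2_iff_forall_hasSurjectiveModNGaloisRep W 3).mpr
    (towerSurj_three_of_surj_of_kodairaSymbolAt_III_or_IIIstar' W v hv hW hsurj)

end Kodaira

end Summit.BirchSwinnertonDyer.Rank1Residual.GaloisImage

end
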